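import Mathlib
import Summits.Schanuel.Schanuel.Statement
import Literature.NumberTheory.Transcendental.RoyCriterion
import Literature.NumberTheory.Transcendental.RoyCriterionProofs
import HarnessLib

/-!
# Padé normal form of Roy's hypothesis: small values on a disc ⟺ high contact at the origin

`Summits/Schanuel/Schanuel/Theorems/SoloBlindPadeNormalForm.lean` (soloist `solo-Schanuel-blind`,
session 10).

Roy (Acta Arith. 97 (2001)) reformulated Schanuel's conjecture in rank `l` as an arithmetic
criterion (Conjecture 2) whose hypothesis is ANALYTIC: non-zero `P_N ∈ ℤ[X₀, X₁]` with
`deg ≤ (N^{t₀}, N^{t₁})`, height `≤ e^N`, and `|(D^k P_N)(Σ mⱼyⱼ, Π αⱼ^{mⱼ})| ≤ e^{-N^u}` on a box of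
translates and derivatives; `SoloBlindUniversalAuxiliary.lean` showed that the hypothesis may be
taken `y`-free: ONE sequence with `sup_{|z| ≤ 1 + cN^{s₁}} |P_N(z, e^z)| ≤ e^{-2N^u}` serves every point
of the graph of `exp` and every rank.

This file removes the analysis altogether.  The Taylor coefficients of `f_P(z) = P(z, e^z)` at
`z = 0` are INTEGERS (`taylorInt n P = (D^n P)(0,1) ∈ ℤ`, in the tree), so by Cauchy's estimate a
polynomial that is small on a disc has its low Taylor coefficients EQUAL TO ZERO; conversely
(Schwarz lemma, in the tree as `norm_le_of_iteratedDeriv_eq_zero`) vanishing of the first `L`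
Taylor coefficients makes `f_P` small on every disc of radius `≪ L/N^{t₁}`.  Precisely:

* `taylorInt_eq_zero_of_norm_le` — if `|P(w, e^w)| ≤ ε` on `|w| = R` and `n! ε < R^n` then
  `taylorInt n P = 0`; in particular (`taylorInt_eq_zero_of_norm_le_exp`) `|P(w,e^w)| ≤ e^{-2X}` on
  `|w| = 1` and `n ≤ Y`, `1 ≤ Y`, `Y log Y < 2X` force `taylorInt n P = 0`.
* `norm_expEval_le_of_taylorInt_eq_zero` — if `deg P ≤ (T₀, T₁)` and `taylorInt n P = 0` for
  `n < L` then `|P(z, e^z)| ≤ 2·2^{-L}·(T₀+1)(T₁+1)·H(P)·R^{T₀}e^{T₁R}` for `|z| ≤ R/2`, `R ≥ 1`.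
* `eventually_forall_taylorInt_eq_zero` / `universal_of_pade` — in exponent form: smallness
  `e^{-2N^u}` on the unit circle alone implies `taylorInt n P = 0` for all `n ≤ N^{u'}`, every
  `u' < u` (all large `N`, uniformly in `P`); and `taylorInt n P_N = 0` for all `n ≤ N^{v}` with
  Roy's profile implies smallness `e^{-2N^u}` on `|z| ≤ 1 + cN^{s₁}` for EVERY `c ≥ 0`, whenever
  `max{1, t₀, s₁+t₁, u} < v`.  Since Roy's window is open in `u`, the two hypothesis classes are
  interchangeable: ROY'S HYPOTHESIS IS "`P_N(w, e^w) = O(w^{N^u})`", an algebraic condition —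
  `P_N` is an integer Hermite–Padé-type form `Σ_b A_b(w)e^{bw} = O(w^{N^u})` for
  `(1, e^w, …, e^{⌊N^{t₁}⌋w})` of sub-maximal order (`N^u` against the generic `N^{t₀+t₁}`) and
  small height `e^N`, i.e. it has contact `≥ N^u` with the formal graph of `exp` at the identity.
* `exists_padeSequence` — such forms exist for every admissible parameter set (the tree's
  `exists_royAuxPoly`, whose Siegel step is exactly this, read back through integrality).
* `schanuelRank_iff_padeCriterion`, `schanuel_iff_padeCriterion` — Schanuel's conjecture in rank
  `l` is equivalent to the PADÉ CRITERION: every sequence of non-zero `P_N ∈ ℤ[X₀,X₁]` with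
  `deg ≤ (N^{t₀}, N^{t₁})`, `H ≤ e^N` and `ord_{w=0} P_N(w, e^w) > N^u` (eventually) forces
  `trdeg_ℚ ℚ(y, e^y) ≥ l` for every `ℚ`-linearly independent `y ∈ ℂ^l` — no disc, no radius, no
  derivatives, no translates in the hypothesis.

Reading.  The group law transports contact with the graph `Γ` of `exp` at the identity to contact
at every `θ ∈ Γ`, which is why the data of Conjecture 2 exist at every point of `Γ` and carry no
information about it: Roy's programme asks Hermite's method (integer Padé-type forms for the
`e^{bw}`, evaluated along `ℤy₁ + ⋯ + ℤy_l`) to yield algebraic independence at TRANSCENDENTAL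
arguments `y`, where no value of the forms is an algebraic number (companion file
`SoloBlindPadeRoyHypothesis.lean`; `wall.md` §2 (W″)).

References: D. Roy, *An arithmetic criterion for the values of the exponential function*, Acta
Arith. 97 (2001) 183–194 (Conjecture 2, Theorem 3, §5); C. Hermite, *Sur la fonction
exponentielle*, C. R. Acad. Sci. Paris 77 (1873); K. Mahler, *Zur Approximation der
Exponentialfunktion und des Logarithmus I*, J. reine angew. Math. 166 (1932) 118–136;
M. Waldschmidt, *Diophantine approximation on linear algebraic groups* (2000), §15.4.
-/

noncomputable section

open Filter Complex MvPolynomial Metric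

namespace Summit.Schanuel.Schanuel.Theorems

open Literature.NumberTheory.Transcendental

/-! ### Small on a circle ⇒ the integer Taylor coefficients vanish -/

/-- **Integrality.** If `|P(w, e^w)| ≤ ε` on the circle `|w| = R` (`R > 0`) and `n!·ε < R^n`, then
the `n`-th Taylor coefficient functional vanishes: `taylorInt n P = (d/dw)^n P(w,e^w)|_{w=0} = 0`
(it is an integer, and Cauchy's estimate bounds it by `n! ε / R^n < 1`). [this work; folklore] -/
theorem taylorInt_eq_zero_of_norm_le (P : MvPolynomial (Fin 2) ℤ) {R ε : ℝ} (hR : 0 < R)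
    (hε : ∀ w ∈ sphere (0 : ℂ) R, ‖expEval P w‖ ≤ ε) {n : ℕ}
    (hn : (n.factorial : ℝ) * ε < R ^ n) : taylorInt n P = 0 := by
  have h := Complex.norm_iteratedDeriv_le_of_forall_mem_sphere_norm_le (f := expEval P) n hR
    (differentiable_expEval P).diffContOnCl hε
  have h1 : ‖(taylorInt n P : ℂ)‖ < 1 := by
    rw [taylorInt_cast]
    calc ‖iteratedDeriv n (expEval P) 0‖ ≤ n.factorial * ε / R ^ n := h
      _ < 1 := by rw [div_lt_one (pow_pos hR n)]; exact hn
  rw [Complex.norm_intCast] at h1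
  have h2 : |taylorInt n P| < 1 := by exact_mod_cast h1
  exact Int.abs_lt_one_iff.1 h2

/-- Radius-one, exponential form: if `|P(w, e^w)| ≤ e^{-2X}` on `|w| = 1` and `n ≤ Y`, `1 ≤ Y`,
`Y log Y < 2X`, then `taylorInt n P = 0` (since `n! ≤ n^n ≤ Y^Y = e^{Y log Y} < e^{2X}`).
[this work] -/
theorem taylorInt_eq_zero_of_norm_le_exp (P : MvPolynomial (Fin 2) ℤ) {X Y : ℝ}
    (hε : ∀ w ∈ sphere (0 : ℂ) 1, ‖expEval P w‖ ≤ Real.exp (-(2 * X))) (hY : 1 ≤ Y)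
    (hXY : Y * Real.log Y < 2 * X) {n : ℕ} (hn : (n : ℝ) ≤ Y) : taylorInt n P = 0 := by
  refine taylorInt_eq_zero_of_norm_le P one_pos hε ?_
  rw [one_pow]
  have hfac : (n.factorial : ℝ) ≤ Real.exp (Y * Real.log Y) := by
    have h1 : (n.factorial : ℝ) ≤ (n : ℝ) ^ n := by exact_mod_cast Nat.factorial_le_pow n
    refine h1.trans ?_
    rcases Nat.eq_zero_or_pos n with rfl | hn0
    · simp only [pow_zero]
      exact Real.one_le_exp (mul_nonneg (zero_le_one.trans hY) (Real.log_nonneg hY))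
    · have hn1 : (1 : ℝ) ≤ n := by exact_mod_cast hn0
      have hnpos : (0 : ℝ) < n := by positivity
      calc ((n : ℝ)) ^ n = Real.exp (n * Real.log n) := by
            rw [← Real.rpow_natCast, Real.rpow_def_of_pos hnpos, mul_comm]
        _ ≤ Real.exp (Y * Real.log Y) := by
            refine Real.exp_le_exp.2 ?_
            exact mul_le_mul hn (Real.log_le_log hnpos hn) (Real.log_nonneg hn1)
              (zero_le_one.trans hY)
  calc (n.factorial : ℝ) * Real.exp (-(2 * X))
      ≤ Real.exp (Y * Real.log Y) * Real.exp (-(2 * X)) := by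
        gcongr
    _ = Real.exp (Y * Real.log Y - 2 * X) := by rw [← Real.exp_add]; ring_nf
    _ < 1 := by
        rw [← Real.exp_zero]
        exact Real.exp_lt_exp.2 (by linarith)

/-! ### The integer Taylor coefficients vanish ⇒ small on discs -/

/-- A polynomial with `deg_{X₀} ≤ T₀`, `deg_{X₁} ≤ T₁` is `polyOfCoeffs` of its coefficient vector on
the box `[0,T₀] × [0,T₁]`. [folklore] -/
theorem polyOfCoeffs_coeff_boxExp (P : MvPolynomial (Fin 2) ℤ) {T₀ T₁ : ℕ}
    (h0 : P.degreeOf 0 ≤ T₀) (h1 : P.degreeOf 1 ≤ T₁) :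
    polyOfCoeffs (fun ab : Fin (T₀ + 1) × Fin (T₁ + 1) => P.coeff (boxExp ab)) = P := by
  classical
  ext m
  by_cases hm : m 0 ≤ T₀ ∧ m 1 ≤ T₁
  · have hab : boxExp ((⟨m 0, Nat.lt_succ_of_le hm.1⟩, ⟨m 1, Nat.lt_succ_of_le hm.2⟩) :
        Fin (T₀ + 1) × Fin (T₁ + 1)) = m := by
      ext i
      fin_cases i <;> simp [boxExp]
    rw [← hab, coeff_polyOfCoeffs]
  · -- outside the box both sides vanish
    have hP : P.coeff m = 0 := by
      by_contra hne
      have hmem : m ∈ P.support := mem_support_iff.2 hne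
      rw [degreeOf_le_iff] at h0 h1
      exact hm ⟨h0 m hmem, h1 m hmem⟩
    rw [hP]
    refine coeff_polyOfCoeffs_eq_zero _ m fun ab hab => ?_
    apply hm
    rw [← hab]
    simp only [boxExp_zero, boxExp_one]
    exact ⟨Nat.lt_succ_iff.1 ab.1.isLt, Nat.lt_succ_iff.1 ab.2.isLt⟩

/-- **Schwarz.** If `deg P ≤ (T₀, T₁)` and `taylorInt n P = 0` for all `n < L`, then for `R ≥ 1`
and `|z| ≤ R/2`: `|P(z, e^z)| ≤ 2 · 2^{-L} · (T₀+1)(T₁+1) · H(P) · R^{T₀} · e^{T₁ R}`.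
[this work; folklore] -/
theorem norm_expEval_le_of_taylorInt_eq_zero (P : MvPolynomial (Fin 2) ℤ) {T₀ T₁ L : ℕ}
    (h0 : P.degreeOf 0 ≤ T₀) (h1 : P.degreeOf 1 ≤ T₁) (hvan : ∀ n < L, taylorInt n P = 0)
    {R : ℝ} (hR : 1 ≤ R) {z : ℂ} (hz : ‖z‖ ≤ R / 2) :
    ‖expEval P z‖ ≤ 2 * (1 / 2) ^ L *
      (((T₀ + 1) * (T₁ + 1) : ℕ) * (mvPolyHeight P : ℝ) * R ^ T₀ * Real.exp (T₁ * R)) := by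
  set t : Fin (T₀ + 1) × Fin (T₁ + 1) → ℤ := fun ab => P.coeff (boxExp ab) with ht
  have hPt : polyOfCoeffs t = P := polyOfCoeffs_coeff_boxExp P h0 h1
  have hRpos : 0 < R := one_pos.trans_le hR
  have hvan' : ∀ n < L, iteratedDeriv n (expEval P) 0 = 0 := by
    intro n hn
    rw [← taylorInt_cast, hvan n hn]; simp
  have htnorm : ‖t‖ ≤ (mvPolyHeight P : ℝ) := by
    refine (pi_norm_le_iff_of_nonneg (Nat.cast_nonneg _)).2 fun ab => ?_
    have h1 : ((P.coeff (boxExp ab)).natAbs : ℝ) ≤ mvPolyHeight P := by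
      exact_mod_cast natAbs_coeff_le_mvPolyHeight P (boxExp ab)
    have h2 : ‖t ab‖ = ((P.coeff (boxExp ab)).natAbs : ℝ) := by
      show ‖P.coeff (boxExp ab)‖ = _
      rw [Int.norm_eq_abs, Nat.cast_natAbs, Int.cast_abs]
    rw [h2]; exact h1
  have hCR : ∀ w ∈ sphere (0 : ℂ) R, ‖expEval P w‖ ≤
      ((T₀ + 1) * (T₁ + 1) : ℕ) * (mvPolyHeight P : ℝ) * R ^ T₀ * Real.exp (T₁ * R) := by
    intro w hw
    have h := norm_expEval_polyOfCoeffs_le t hR w hw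
    rw [hPt] at h
    refine h.trans ?_
    gcongr
  exact norm_le_of_iteratedDeriv_eq_zero (differentiable_expEval P) hRpos hvan' hCR hz

/-! ### Sequences: the two hypothesis classes are interchangeable -/

/-- **Small ⇒ Padé, with exponents.** For `0 < u` and `u' < u`, for all large `N`: every
`P ∈ ℤ[X₀,X₁]` with `|P(w, e^w)| ≤ e^{-2N^u}` on the unit circle has `taylorInt n P = 0` for all
`n ≤ N^{u'}` (no degree or height hypothesis is needed). [this work] -/
theorem eventually_forall_taylorInt_eq_zero {u u' : ℝ} (hu : 0 < u) (hu' : u' < u) :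
    ∀ᶠ N : ℕ in atTop, ∀ P : MvPolynomial (Fin 2) ℤ,
      (∀ w ∈ sphere (0 : ℂ) 1, ‖expEval P w‖ ≤ Real.exp (-(2 * (N : ℝ) ^ u))) →
        ∀ n : ℕ, (n : ℝ) ≤ (N : ℝ) ^ u' → taylorInt n P = 0 := by
  set v : ℝ := max u' 0 with hv
  have hvu : v < u := max_lt hu' hu
  have hv0 : 0 ≤ v := le_max_right _ _
  have H : ∀ᶠ x : ℝ in atTop, v * x ^ v * Real.log x ≤ 1 * x ^ u :=
    eventually_mul_rpow_mul_log_le hvu hv0 one_pos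
  filter_upwards [tendsto_natCast_atTop_atTop.eventually H, eventually_ge_atTop 1]
    with N hN hN1 P hP n hn
  have hx1 : (1 : ℝ) ≤ (N : ℝ) := by exact_mod_cast hN1
  have hx0 : (0 : ℝ) < (N : ℝ) := one_pos.trans_le hx1
  have hY1 : (1 : ℝ) ≤ (N : ℝ) ^ v := Real.one_le_rpow hx1 hv0
  have hnY : (n : ℝ) ≤ (N : ℝ) ^ v :=
    hn.trans (Real.rpow_le_rpow_of_exponent_le hx1 (le_max_left _ _))
  have hpos : (0 : ℝ) < (N : ℝ) ^ u := Real.rpow_pos_of_pos hx0 u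
  have hXY : (N : ℝ) ^ v * Real.log ((N : ℝ) ^ v) < 2 * (N : ℝ) ^ u := by
    rw [Real.log_rpow hx0]
    calc (N : ℝ) ^ v * (v * Real.log N) = v * (N : ℝ) ^ v * Real.log N := by ring
      _ ≤ 1 * (N : ℝ) ^ u := hN
      _ < 2 * (N : ℝ) ^ u := by linarith
  exact taylorInt_eq_zero_of_norm_le_exp P hP hY1 hXY hnY

/-- **Padé ⇒ small, with exponents.** Let `0 ≤ s₁, t₀, t₁`, `max{1, t₀, s₁ + t₁, u} < v` and
`c ≥ 0`.  If `deg P_N ≤ (N^{t₀}, N^{t₁})`, `H(P_N) ≤ e^N` and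
`taylorInt n P_N = 0` for all `n ≤ N^v` (eventually), then eventually
`|P_N(z, e^z)| ≤ e^{-2N^u}` for all `|z| ≤ 1 + cN^{s₁}` — the hypothesis of
`schanuelRank_iff_universalSequence`.  (Schwarz lemma on the disc of radius `2(1 + cN^{s₁})` and
the bookkeeping `log 2 - N^v log 2 + log M + N + T₀ log R + T₁R ≤ -2N^u`.) [this work] -/
theorem universal_of_pade {s₁ t₀ t₁ u v : ℝ} (hs₁ : 0 ≤ s₁) (ht₀ : 0 ≤ t₀) (ht₁ : 0 ≤ t₁)
    (h1v : 1 < v) (ht₀v : t₀ < v) (hstv : s₁ + t₁ < v) (huv : u < v)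
    {c : ℝ} (hc : 0 ≤ c) (P : ℕ → MvPolynomial (Fin 2) ℤ)
    (hP : ∀ᶠ N : ℕ in atTop,
      ((P N).degreeOf 0 : ℝ) ≤ (N : ℝ) ^ t₀ ∧ ((P N).degreeOf 1 : ℝ) ≤ (N : ℝ) ^ t₁ ∧
      (mvPolyHeight (P N) : ℝ) ≤ Real.exp N ∧
      ∀ n : ℕ, (n : ℝ) ≤ (N : ℝ) ^ v → taylorInt n (P N) = 0) :
    ∀ᶠ N : ℕ in atTop, ∀ z : ℂ, ‖z‖ ≤ 1 + c * (N : ℝ) ^ s₁ →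
      ‖expEval (P N) z‖ ≤ Real.exp (-(2 * (N : ℝ) ^ u)) := by
  have hl2 : 0 < Real.log 2 := Real.log_pos one_lt_two
  have q8 : (0 : ℝ) < Real.log 2 / 8 := by positivity
  have hv0 : 0 < v := one_pos.trans h1v
  -- growth bookkeeping in a real variable `x`
  have H : ∀ᶠ x : ℝ in atTop,
      Real.log 2 - ((⌊x ^ v⌋₊ + 1 : ℕ) : ℝ) * Real.log 2 +
          Real.log (((⌊x ^ t₀⌋₊ + 1) * (⌊x ^ t₁⌋₊ + 1) : ℕ) : ℝ) + x +
          (⌊x ^ t₀⌋₊ : ℝ) * Real.log (2 * (1 + c * x ^ s₁)) +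
          (⌊x ^ t₁⌋₊ : ℝ) * (2 * (1 + c * x ^ s₁)) ≤ -(2 * x ^ u) := by
    filter_upwards [eventually_ge_atTop (1 : ℝ),
      eventually_const_le_mul_rpow (Real.log 2 + Real.log 4) hv0 q8,
      eventually_mul_rpow_mul_log_le hv0 (show (0 : ℝ) ≤ t₀ + t₁ by linarith) q8,
      eventually_mul_rpow_le_mul_rpow 1 h1v q8,
      eventually_mul_rpow_le_mul_rpow (Real.log (2 + 2 * c)) ht₀v q8,
      eventually_mul_rpow_mul_log_le ht₀v hs₁ q8,
      eventually_mul_rpow_le_mul_rpow (2 + 2 * c) hstv q8,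
      eventually_mul_rpow_le_mul_rpow 2 huv q8]
      with x hx1 Ec1 Ec2 Ec3 Ec4 Ec5 Ec6 Ec7
    have hx0 : 0 < x := one_pos.trans_le hx1
    have hxpos : ∀ s : ℝ, 0 < x ^ s := fun s => Real.rpow_pos_of_pos hx0 s
    have hx1t : ∀ {s : ℝ}, 0 ≤ s → 1 ≤ x ^ s := fun hs => Real.one_le_rpow hx1 hs
    have hlogx : 0 ≤ Real.log x := Real.log_nonneg hx1
    set T₀ : ℕ := ⌊x ^ t₀⌋₊ with hT₀def
    set T₁ : ℕ := ⌊x ^ t₁⌋₊ with hT₁def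
    set L : ℕ := ⌊x ^ v⌋₊ + 1 with hLdef
    have hT₀ : (T₀ : ℝ) ≤ x ^ t₀ := Nat.floor_le (hxpos t₀).le
    have hT₁ : (T₁ : ℝ) ≤ x ^ t₁ := Nat.floor_le (hxpos t₁).le
    have hLgt : x ^ v < L := by rw [hLdef]; push_cast; exact Nat.lt_floor_add_one _
    have hMdef : (((T₀ + 1) * (T₁ + 1) : ℕ) : ℝ) = ((T₀ : ℝ) + 1) * ((T₁ : ℝ) + 1) := by
      push_cast; ring
    set M : ℝ := (((T₀ + 1) * (T₁ + 1) : ℕ) : ℝ) with hMset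
    have hMle : M ≤ 4 * x ^ (t₀ + t₁) := by
      rw [hMdef, Real.rpow_add hx0]
      have h0 : (T₀ : ℝ) + 1 ≤ 2 * x ^ t₀ := by linarith [hx1t ht₀]
      have h1 : (T₁ : ℝ) + 1 ≤ 2 * x ^ t₁ := by linarith [hx1t ht₁]
      calc ((T₀ : ℝ) + 1) * ((T₁ : ℝ) + 1) ≤ (2 * x ^ t₀) * (2 * x ^ t₁) := by gcongr
        _ = 4 * (x ^ t₀ * x ^ t₁) := by ring
    have hMpos : 0 < M := by
      rw [hMdef]; positivity
    set R : ℝ := 2 * (1 + c * x ^ s₁) with hRdef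
    have hcx : 0 ≤ c * x ^ s₁ := mul_nonneg hc (hxpos s₁).le
    have hRpos : 0 < R := by rw [hRdef]; linarith
    have hRle : R ≤ (2 + 2 * c) * x ^ s₁ := by
      have := hx1t hs₁
      rw [hRdef]; linarith
    have hlogR0 : 0 ≤ Real.log R := Real.log_nonneg (by rw [hRdef]; linarith)
    have hlogR : Real.log R ≤ Real.log (2 + 2 * c) + s₁ * Real.log x := by
      calc Real.log R ≤ Real.log ((2 + 2 * c) * x ^ s₁) := Real.log_le_log hRpos hRle
        _ = Real.log (2 + 2 * c) + s₁ * Real.log x := by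
            rw [Real.log_mul (by positivity) (hxpos _).ne', Real.log_rpow hx0]
    have h1 : Real.log M ≤ Real.log 4 + (t₀ + t₁) * Real.log x := by
      calc Real.log M ≤ Real.log (4 * x ^ (t₀ + t₁)) := Real.log_le_log hMpos hMle
        _ = Real.log 4 + (t₀ + t₁) * Real.log x := by
            rw [Real.log_mul (by norm_num) (hxpos _).ne', Real.log_rpow hx0]
    have h2 : (T₀ : ℝ) * Real.log R ≤ x ^ t₀ * (Real.log (2 + 2 * c) + s₁ * Real.log x) :=
      mul_le_mul hT₀ hlogR hlogR0 (hxpos _).le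
    have h3 : (T₁ : ℝ) * R ≤ (2 + 2 * c) * x ^ (s₁ + t₁) := by
      calc (T₁ : ℝ) * R ≤ x ^ t₁ * ((2 + 2 * c) * x ^ s₁) :=
            mul_le_mul hT₁ hRle hRpos.le (hxpos _).le
        _ = (2 + 2 * c) * x ^ (s₁ + t₁) := by rw [Real.rpow_add hx0]; ring
    have h4 : -((L : ℝ) * Real.log 2) ≤ -(x ^ v * Real.log 2) := by
      have := mul_le_mul_of_nonneg_right hLgt.le hl2.le
      linarith
    have hx : x ^ (1 : ℝ) = x := Real.rpow_one x
    have hx0' : x ^ (0 : ℝ) = 1 := Real.rpow_zero x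
    rw [hx] at Ec3
    rw [hx0', mul_one] at Ec2
    linarith [h1, h2, h3, h4, Ec1, Ec2, Ec3, Ec4, Ec5, Ec6, Ec7, (hxpos v).le, (hxpos t₀).le,
      hlogx]
  filter_upwards [hP, tendsto_natCast_atTop_atTop.eventually H] with N hN hsmall z hz
  obtain ⟨hd0, hd1, hH, hvan⟩ := hN
  set x : ℝ := (N : ℝ) with hxdef
  have hx0 : (0 : ℝ) ≤ x := Nat.cast_nonneg N
  set T₀ : ℕ := ⌊x ^ t₀⌋₊ with hT₀def
  set T₁ : ℕ := ⌊x ^ t₁⌋₊ with hT₁def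
  set L : ℕ := ⌊x ^ v⌋₊ + 1 with hLdef
  have h0 : (P N).degreeOf 0 ≤ T₀ := Nat.le_floor hd0
  have h1 : (P N).degreeOf 1 ≤ T₁ := Nat.le_floor hd1
  have hvan' : ∀ n < L, taylorInt n (P N) = 0 := fun n hn =>
    hvan n ((Nat.le_floor_iff (Real.rpow_nonneg hx0 v)).1 (Nat.lt_succ_iff.1 hn))
  set R : ℝ := 2 * (1 + c * x ^ s₁) with hRdef
  have hcx : 0 ≤ c * x ^ s₁ := mul_nonneg hc (Real.rpow_nonneg hx0 _)
  have hR1 : 1 ≤ R := by rw [hRdef]; linarith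
  have hRpos : 0 < R := one_pos.trans_le hR1
  have hzR : ‖z‖ ≤ R / 2 := by rw [hRdef]; linarith
  refine (norm_expEval_le_of_taylorInt_eq_zero (P N) h0 h1 hvan' hR1 hzR).trans ?_
  set M : ℝ := (((T₀ + 1) * (T₁ + 1) : ℕ) : ℝ) with hMset
  have hMpos : 0 < M := by rw [hMset]; positivity
  have eL : ((1 : ℝ) / 2) ^ L = Real.exp (-((L : ℝ) * Real.log 2)) := by
    rw [Real.exp_neg, Real.exp_nat_mul, Real.exp_log two_pos, one_div, inv_pow]
  have eR : R ^ T₀ = Real.exp ((T₀ : ℝ) * Real.log R) := by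
    rw [Real.exp_nat_mul, Real.exp_log hRpos]
  calc 2 * ((1 : ℝ) / 2) ^ L * (M * (mvPolyHeight (P N) : ℝ) * R ^ T₀ * Real.exp (T₁ * R))
      ≤ 2 * ((1 : ℝ) / 2) ^ L * (M * Real.exp N * R ^ T₀ * Real.exp (T₁ * R)) := by gcongr
    _ = Real.exp (Real.log 2) * Real.exp (-((L : ℝ) * Real.log 2)) *
          (Real.exp (Real.log M) * Real.exp N * Real.exp ((T₀ : ℝ) * Real.log R) *
            Real.exp (T₁ * R)) := by
        rw [← eL, ← eR, Real.exp_log two_pos, Real.exp_log hMpos]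
    _ = Real.exp (Real.log 2 - L * Real.log 2 + Real.log M + N + T₀ * Real.log R + T₁ * R) := by
        simp only [sub_eq_add_neg, Real.exp_add]; ring
    _ ≤ Real.exp (-(2 * x ^ u)) := Real.exp_le_exp.2 hsmall

/-! ### Existence, and the Padé criterion -/

/-- **Integer Padé-type forms of sub-maximal order exist** for every admissible parameter set:
eventually there is a non-zero `P_N ∈ ℤ[X₀,X₁]`, `deg ≤ (N^{t₀}, N^{t₁})`, `H(P_N) ≤ e^N`, with
`taylorInt n P_N = 0` for all `n ≤ N^u`, i.e. `P_N(w, e^w) = O(w^{⌊N^u⌋+1})`.  (The tree's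
`exists_royAuxPoly` at the larger admissible exponent `λ = royLambda t₀ t₁ u`, read back through
`eventually_forall_taylorInt_eq_zero`.) [this work; Siegel's lemma] -/
theorem exists_padeSequence {s₀ s₁ t₀ t₁ u : ℝ} (hadm : RoyAdmissible s₀ s₁ t₀ t₁ u) :
    ∀ᶠ N : ℕ in atTop, ∃ P : MvPolynomial (Fin 2) ℤ, P ≠ 0 ∧
      (P.degreeOf 0 : ℝ) ≤ (N : ℝ) ^ t₀ ∧ (P.degreeOf 1 : ℝ) ≤ (N : ℝ) ^ t₁ ∧
      (mvPolyHeight P : ℝ) ≤ Real.exp N ∧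
      ∀ n : ℕ, (n : ℝ) ≤ (N : ℝ) ^ u → taylorInt n P = 0 := by
  have ⟨hs₀, hs₁, ht₀, ht₁, hu, h1, h2, h3⟩ := hadm
  set v : ℝ := royLambda t₀ t₁ u with hv
  have huv : u < v := by rw [hv, royLambda]; linarith
  have hv3 : v < (1 + t₀ + t₁) / 2 := by rw [hv, royLambda]; linarith
  have hadm' : RoyAdmissible s₀ s₁ t₀ t₁ v :=
    ⟨hs₀, hs₁, ht₀, ht₁, hu.trans huv, h1, h2.trans huv, hv3⟩
  filter_upwards [exists_royAuxPoly hadm' (le_refl (0 : ℝ)),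
    eventually_forall_taylorInt_eq_zero (hu.trans huv) huv] with N hN hN'
  obtain ⟨P, hP0, hd0, hd1, hH, hval⟩ := hN
  refine ⟨P, hP0, hd0, hd1, hH, hN' P fun w hw => hval w ?_⟩
  have hw1 : ‖w‖ = 1 := by simpa using hw
  rw [hw1, zero_mul, add_zero]

/-- **Schanuel in rank `l` ⟺ the Padé criterion.**  Fix admissible parameters.  `SchanuelRank l`
holds iff EVERY sequence of non-zero `P_N ∈ ℤ[X₀,X₁]` with `deg ≤ (N^{t₀}, N^{t₁})`,
`H(P_N) ≤ e^N` and `taylorInt n P_N = 0` for all `n ≤ N^u` (all large `N`) forces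
`l ≤ trdeg_ℚ ℚ(y, e^y)` for every `ℚ`-linearly independent `y : Fin l → ℂ`.  (`→` is trivial;
`←` is `exists_padeSequence`.  The hypothesis is purely algebraic: no point, no disc, no
derivatives, no translates.) [this work] -/
theorem schanuelRank_iff_padeCriterion {s₀ s₁ t₀ t₁ u : ℝ}
    (hadm : RoyAdmissible s₀ s₁ t₀ t₁ u) (l : ℕ) :
    SchanuelRank l ↔
      ∀ (P : ℕ → MvPolynomial (Fin 2) ℤ),
        (∀ᶠ N : ℕ in atTop, P N ≠ 0 ∧
          ((P N).degreeOf 0 : ℝ) ≤ (N : ℝ) ^ t₀ ∧ ((P N).degreeOf 1 : ℝ) ≤ (N : ℝ) ^ t₁ ∧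
          (mvPolyHeight (P N) : ℝ) ≤ Real.exp N ∧
          ∀ n : ℕ, (n : ℝ) ≤ (N : ℝ) ^ u → taylorInt n (P N) = 0) →
        ∀ (y : Fin l → ℂ), LinearIndependent ℚ y →
          (l : Cardinal) ≤ Algebra.trdeg ℚ
            ↥(IntermediateField.adjoin ℚ (Set.range y ∪ Set.range (cexp ∘ y))) := by
  classical
  refine ⟨fun h P _ y hy => h y hy, fun h y hy => ?_⟩
  let good : ℕ → MvPolynomial (Fin 2) ℤ → Prop := fun N Q =>
    Q ≠ 0 ∧ (Q.degreeOf 0 : ℝ) ≤ (N : ℝ) ^ t₀ ∧ (Q.degreeOf 1 : ℝ) ≤ (N : ℝ) ^ t₁ ∧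
      (mvPolyHeight Q : ℝ) ≤ Real.exp N ∧
      ∀ n : ℕ, (n : ℝ) ≤ (N : ℝ) ^ u → taylorInt n Q = 0
  let P : ℕ → MvPolynomial (Fin 2) ℤ := fun N =>
    if hN : ∃ Q, good N Q then hN.choose else 0
  have hP : ∀ᶠ N : ℕ in atTop, good N (P N) := by
    filter_upwards [exists_padeSequence hadm] with N hN
    have hex : ∃ Q, good N Q := hN
    show good N (if hN : ∃ Q, good N Q then hN.choose else 0)
    rw [dif_pos hex]
    exact hex.choose_spec
  exact h P hP y hy

/-- The same for the summit: Schanuel's conjecture holds iff the Padé criterion holds in every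
rank (for one, equivalently every, admissible parameter set). [this work] -/
theorem schanuel_iff_padeCriterion {s₀ s₁ t₀ t₁ u : ℝ} (hadm : RoyAdmissible s₀ s₁ t₀ t₁ u) :
    _root_.Schanuel ↔ ∀ l : ℕ,
      ∀ (P : ℕ → MvPolynomial (Fin 2) ℤ),
        (∀ᶠ N : ℕ in atTop, P N ≠ 0 ∧
          ((P N).degreeOf 0 : ℝ) ≤ (N : ℝ) ^ t₀ ∧ ((P N).degreeOf 1 : ℝ) ≤ (N : ℝ) ^ t₁ ∧
          (mvPolyHeight (P N) : ℝ) ≤ Real.exp N ∧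
          ∀ n : ℕ, (n : ℝ) ≤ (N : ℝ) ^ u → taylorInt n (P N) = 0) →
        ∀ (y : Fin l → ℂ), LinearIndependent ℚ y →
          (l : Cardinal) ≤ Algebra.trdeg ℚ
            ↥(IntermediateField.adjoin ℚ (Set.range y ∪ Set.range (cexp ∘ y))) :=
  forall_congr' fun l => schanuelRank_iff_padeCriterion hadm l

end Summit.Schanuel.Schanuel.Theorems

end
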